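import Summits.QuantumAdvantage.QuantumAdvantage.Theorems.CubicForrelationNearExactIsExactEighteenPairing

/-!
# Crux `CubicForrelation.NearExactIsExact` (stmt-QuantumAdvantage-14043) — n = 18, TWO-SIDED: a type-O cubic never reaches `Φ = 63/64`

Certificate seat `b2b-cforr-cert` (gen 6).  HONEST FRAMING: a theorem about cubic Boolean functions on 18 bits (finite slice `n = 18` of the
crux) — the type-O boundary configuration of the certified bound `θ₁₈ ≤ 63/64` (gen 3, one-sided) is excluded two-sidedly; NOT summit progress.

`et_typeO_eighteen_lt`: for cubic `f, g : 𝔽₂¹⁸ → 𝔽₂` with `W_g = 64u` and ALL `u` odd (type O), `Φ(f,g) < 63/64`.  Proof: with `s = (−1)^f`,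
`τ = u − 8s` and the digits `d₁ = [⌊u/2⌋ odd]` (AFFINE, `ei_digitOne`), `d₂ = [⌊u/4⌋ odd]` (cubic, `ei_digitTwo`):
* pointwise `(u − 8s)² ≥ 1 + 8·[d₁ ≠ d₂]` (`et_pt`), `A = {d₁ ≠ d₂}` is non-empty (`ei_no_caseA`) of degree `≤ 3`, so `#A ≥ 2¹⁵` and the
  budget `Σ τ² = 2²⁵(1 − Φ) ≤ 2¹⁹ = 2¹⁸ + 8·2¹⁵` is spent exactly: `Φ = 63/64`, `A` is a 15-flat, `τ = (−1)^{d₁}` off `A`, `τ = −3(−1)^{d₁}` on `A`;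
* `(−1)^{d₁}` is a `±`character (one frequency of modulus `2¹⁸`) and `(−1)^{d₁}1_A` has all of `V_A` as periods up to sign (eight frequencies
  of modulus `2¹⁵`): `Σ_y |τ̂(y)| ≤ 2¹⁸ + 4·2¹⁸` (`fp_l1_sq_mul_le`);
* but the pairing identity needs `Σ_y (−1)^{g(y)} τ̂(y) = 2³⁰(1 − Φ) = 2²⁴` (`ep_pairing18`). Contradiction.

References: J. Ax (1964) / R. J. McEliece (1972); MacWilliams–Sloane (1977) Ch. 13–15; R. O'Donnell (2014) §3.3.  Everything below is proved
from Mathlib and the tree; axioms are the standard three.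
-/

set_option linter.dupNamespace false -- D-0017: single-problem summit ⇒ `QuantumAdvantage.QuantumAdvantage` by design

noncomputable section

namespace Summit.QuantumAdvantage.QuantumAdvantage.Theorems.CubicForrelation.NearExactIsExact

open Finset
open Literature.Computability.QuantumComplexity
open Literature.Computability.QuantumComplexity.BuzetChailloux (bxor zeroVec bxor_bxor_cancel_left bxor_zeroVec zeroVec_bxor bxor_comm
  bxor_self)
open Literature.Computability.QuantumComplexity.DerivativeWalsh (W)

/-- **The two-sided pointwise inequality at 18 bits (type O).** For odd `v` and `s = ±1`:
`1 + 8·[d₁ ≠ d₂] ≤ (v − 8s)²` (`v − 8s ≡ v + 8 (mod 16)`; `d₁ = d₂ ⟺ v ≡ ±1 (mod 8)`). [this work] -/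
theorem et_pt (v s : ℤ) (hv : Odd v) (hs : s = 1 ∨ s = -1) :
    1 + 8 * (if ¬ (Odd (v / 2) ↔ Odd (v / 2 / 2)) then 1 else 0) ≤ (v - 8 * s) ^ 2 := by
  rcases le_or_gt 16 |v| with h16 | h16
  · have hbig : (64 : ℤ) ≤ (v - 8 * s) ^ 2 := by
      have h8 : v - 8 * s ≤ -8 ∨ 8 ≤ v - 8 * s := by
        rcases hs with rfl | rfl
        · rcases le_or_gt 0 v with hv0 | hv0
          · rw [abs_of_nonneg hv0] at h16; omega
          · rw [abs_of_neg hv0] at h16; omega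
        · rcases le_or_gt 0 v with hv0 | hv0
          · rw [abs_of_nonneg hv0] at h16; omega
          · rw [abs_of_neg hv0] at h16; omega
      exact tp_sq_ge (k := 8) (by norm_num) h8
    have hconst : 1 + 8 * (if ¬ (Odd (v / 2) ↔ Odd (v / 2 / 2)) then 1 else 0) ≤ (9 : ℤ) := by split_ifs <;> norm_num
    linarith
  · have h1 : -15 ≤ v := by have := (abs_lt.1 h16).1; omega
    have h2 : v ≤ 15 := by have := (abs_lt.1 h16).2; omega
    rcases hs with rfl | rfl <;> interval_cases v <;> (try (exfalso; norm_num [Int.odd_iff] at hv; done)) <;> norm_num [Int.odd_iff]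

/-- **A type-O cubic on 18 bits never reaches `Φ = 63/64`.**  For cubic `f, g : 𝔽₂¹⁸ → 𝔽₂` with `W_g = 64u` and every `u(x)` odd:
`Φ(f,g) < 63/64` (two-sided: budget ⇒ residual `(−1)^{d₁}(1 − 4·1_A)` with `d₁` affine and `A` a 15-flat; few frequencies vs the pairing
`2²⁴`).  Finite-slice statement; NOT summit progress. [this work] -/
theorem et_typeO_eighteen_lt (f g : (Fin (9 + 9) → Bool) → Bool) (hf : IsDegLeFun 3 f) (hg : IsDegLeFun 3 g)
    (u : (Fin (9 + 9) → Bool) → ℤ) (hu : ∀ x, W (fun y => signOf (g y)) x = (2 : ℝ) ^ 6 * (u x : ℝ))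
    (hodd : ∀ x, Odd (u x)) : forrelation f g < 63 / 64 := by
  classical
  have _hf := hf
  by_contra hge
  push Not at hge
  have hd1 : IsDegLeFun 1 (fun x => decide (Odd (u x / 2))) := ei_digitOne g u hg hu hodd
  have hd2 : IsDegLeFun 3 (fun x => decide (Odd (u x / 2 / 2))) := ei_digitTwo g u hg hu hodd
  set A := univ.filter (fun x : Fin (9 + 9) → Bool => ¬ (Odd (u x / 2) ↔ Odd (u x / 2 / 2))) with hAdef
  have hmemA : ∀ x, x ∈ A ↔ ¬ (Odd (u x / 2) ↔ Odd (u x / 2 / 2)) := fun x => by simp [hAdef]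
  -- `A` as the support of the degree-3 function `d₁ ⊕ d₂`
  have hdegA : IsDegLeFun (2 + 1) (fun x => decide (Odd (u x / 2)) ^^ decide (Odd (u x / 2 / 2))) :=
    bb_isDegLeFun_bxor (hd1.mono (by norm_num)) hd2
  have hsetA : (univ.filter fun x : Fin (9 + 9) → Bool =>
      (decide (Odd (u x / 2)) ^^ decide (Odd (u x / 2 / 2))) = true) = A := by
    rw [hAdef]
    apply filter_congr
    intro x _
    by_cases h1 : Odd (u x / 2) <;> by_cases h2 : Odd (u x / 2 / 2) <;> simp [h1, h2]
  have hne : ∃ x, (decide (Odd (u x / 2)) ^^ decide (Odd (u x / 2 / 2))) = true := by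
    by_contra hnone
    push Not at hnone
    refine ei_no_caseA g u hg hu hodd fun x => ?_
    have hx := hnone x
    by_cases h1 : Odd (u x / 2) <;> by_cases h2 : Odd (u x / 2 / 2) <;> simp [h1, h2] at hx ⊢
  have hrm := bb_rmWeight_holds (9 + 9) 3 _ (hdegA) hne
  rw [hsetA] at hrm
  have hAge : 2 ^ 15 ≤ #A := by
    have h2 : (2 : ℕ) ^ (9 + 9) = 2 ^ 3 * 2 ^ 15 := by norm_num
    rw [h2] at hrm
    exact Nat.le_of_mul_le_mul_left hrm (by positivity)
  -- budget and the pointwise cost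
  have hbud := ep_budget18 f g u hu
  have hT : (∑ x, (u x - 8 * sZ (f x)) ^ 2 : ℤ) ≤ 2 ^ 19 := by
    have h' : ((∑ x, (u x - 8 * sZ (f x)) ^ 2 : ℤ) : ℝ) ≤ 2 ^ 19 := by rw [hbud]; nlinarith
    exact_mod_cast h'
  have hsumA : (∑ x, (if ¬ (Odd (u x / 2) ↔ Odd (u x / 2 / 2)) then 1 else 0 : ℤ)) = #A := by rw [sum_boole]
  have hnonneg : ∀ x, 0 ≤ (u x - 8 * sZ (f x)) ^ 2 - (1 + 8 * (if ¬ (Odd (u x / 2) ↔ Odd (u x / 2 / 2)) then 1 else 0 : ℤ)) :=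
    fun x => by have := et_pt (u x) (sZ (f x)) (hodd x) (tp_sZ_cases (f x)); linarith
  have hsum0 : ∑ x, ((u x - 8 * sZ (f x)) ^ 2 - (1 + 8 * (if ¬ (Odd (u x / 2) ↔ Odd (u x / 2 / 2)) then 1 else 0 : ℤ))) = 0 := by
    refine le_antisymm ?_ (sum_nonneg fun x _ => hnonneg x)
    rw [sum_sub_distrib, sum_add_distrib, ← mul_sum, hsumA, sum_const, card_univ, Fintype.card_fun, Fintype.card_bool,
      Fintype.card_fin]
    have : (2 : ℤ) ^ 15 ≤ #A := by exact_mod_cast hAge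
    norm_num
    linarith
  have hpt : ∀ x, (u x - 8 * sZ (f x)) ^ 2 = 1 + 8 * (if ¬ (Odd (u x / 2) ↔ Odd (u x / 2 / 2)) then 1 else 0 : ℤ) :=
    fun x => by have := (sum_eq_zero_iff_of_nonneg fun y _ => hnonneg y).1 hsum0 x (mem_univ x); linarith
  have hAcard : #A = 2 ^ 15 := by
    have hT' : (2 : ℤ) ^ 18 + 8 * #A ≤ 2 ^ 19 := by
      have e : (∑ x, (u x - 8 * sZ (f x)) ^ 2 : ℤ) = 2 ^ 18 + 8 * #A := by
        rw [sum_congr rfl fun x _ => hpt x, sum_add_distrib, ← mul_sum, hsumA, sum_const, card_univ, Fintype.card_fun,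
          Fintype.card_bool, Fintype.card_fin]
        norm_num
      rw [← e]; exact hT
    have hle : #A ≤ 2 ^ 15 := by
      have : (#A : ℤ) ≤ 2 ^ 15 := by linarith
      exact_mod_cast this
    omega
  have hΦeq : forrelation f g = 63 / 64 := by
    have e : (∑ x, (u x - 8 * sZ (f x)) ^ 2 : ℤ) = 2 ^ 19 := by
      rw [sum_congr rfl fun x _ => hpt x, sum_add_distrib, ← mul_sum, hsumA, sum_const, card_univ, Fintype.card_fun,
        Fintype.card_bool, Fintype.card_fin, hAcard]
      norm_num
    have h : ((∑ x, (u x - 8 * sZ (f x)) ^ 2 : ℤ) : ℝ) = 2 ^ 19 := by exact_mod_cast e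
    rw [hbud] at h
    linarith
  -- the residual
  have hτ1 : ∀ x, x ∉ A → u x - 8 * sZ (f x) = sZ (decide (Odd (u x / 2))) := by
    intro x hx
    have h := hpt x
    rw [if_neg (fun h' => hx ((hmemA x).2 h'))] at h
    have h1 : (u x - 8 * sZ (f x)) * (u x - 8 * sZ (f x)) = 1 := by rw [← pow_two]; linarith
    exact ep_tau_one (mul_self_eq_one_iff.1 h1)
  have hτ3 : ∀ x, x ∈ A → u x - 8 * sZ (f x) = -3 * sZ (decide (Odd (u x / 2))) := by
    intro x hx
    have h := hpt x
    rw [if_pos ((hmemA x).1 hx)] at h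
    exact ep_tau_three (by linarith)
  -- `A` is a 15-flat
  have hmwA := mw_flat_of_minweight 2 _ hdegA (by rw [hsetA, hAcard]; norm_num)
  rw [hsetA] at hmwA
  obtain ⟨h0A, haddA, hcardVA, hcosetA⟩ := hmwA
  set VA := univ.filter (fun a : Fin (9 + 9) → Bool => ∀ x,
    (decide (Odd (u (bxor x a) / 2)) ^^ decide (Odd (u (bxor x a) / 2 / 2))) =
      (decide (Odd (u x / 2)) ^^ decide (Odd (u x / 2 / 2)))) with hVA
  rw [hAcard] at hcardVA
  obtain ⟨xA, hxA⟩ : A.Nonempty := by rw [← card_pos, hAcard]; norm_num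
  have hSA : A = VA.image (bxor xA) := hcosetA xA (by
    have h := (hmemA xA).1 hxA
    by_cases h1 : Odd (u xA / 2) <;> by_cases h2 : Odd (u xA / 2 / 2) <;> simp [h1, h2] <;> tauto)
  -- `d₁` is affine: every translation is a period up to sign of `(−1)^{d₁}`
  have hDconst : ∀ a x : Fin (9 + 9) → Bool,
      decide (Odd (u (bxor x a) / 2)) = (decide (Odd (u x / 2)) ^^ (decide (Odd (u zeroVec / 2)) ^^ decide (Odd (u a / 2)))) := by
    intro a x
    have hc := tc_const_of_deg_zero (stub_derivDegree (9 + 9) 0 (fun x => decide (Odd (u x / 2))) a hd1) x zeroVec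
    simp only [zeroVec_bxor] at hc
    revert hc
    cases decide (Odd (u (bxor x a) / 2)) <;> cases decide (Odd (u x / 2)) <;> cases decide (Odd (u zeroVec / 2)) <;>
      cases decide (Odd (u a / 2)) <;> decide
  set A₁ : (Fin (9 + 9) → Bool) → ℝ := fun x => signOf (decide (Odd (u x / 2))) with hA₁
  set A₂ : (Fin (9 + 9) → Bool) → ℝ := fun x => if x ∈ A then signOf (decide (Odd (u x / 2))) else 0 with hA₂
  have h1b := fp_l1_sq_mul_le A₁ univ univ (fun x _ => by simp only [A₁]; unfold signOf; split_ifs <;> simp)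
    (fun x hx => absurd (mem_univ x) hx) (mem_univ _) (fun a _ b _ => mem_univ _) (fun a _ => by
      refine ⟨signOf (decide (Odd (u zeroVec / 2)) ^^ decide (Odd (u a / 2))), ?_, fun x => ?_⟩
      · unfold signOf; split_ifs <;> simp
      · simp only [A₁]; rw [hDconst a x, signOf_xor]; ring)
  rw [card_univ, Fintype.card_fun, Fintype.card_bool, Fintype.card_fin] at h1b
  have hX : ∑ y, |W A₁ y| ≤ 2 ^ 18 := by
    have hnn : 0 ≤ ∑ y, |W A₁ y| := sum_nonneg fun y _ => abs_nonneg _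
    push_cast at h1b
    nlinarith
  have h2b := fp_l1_sq_mul_le A₂ A VA (fun x hx => by
      simp only [A₂, if_pos hx]; unfold signOf; split_ifs <;> simp) (fun x hx => by simp only [A₂, if_neg hx]) h0A haddA
    (fun a ha => by
      refine ⟨signOf (decide (Odd (u zeroVec / 2)) ^^ decide (Odd (u a / 2))), ?_, fun x => ?_⟩
      · unfold signOf; split_ifs <;> simp
      · by_cases hx : x ∈ A
        · have hxa : bxor x a ∈ A := fl1_coset_vadd haddA hSA hx ha
          simp only [A₂, if_pos hx, if_pos hxa]; rw [hDconst a x, signOf_xor]; ring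
        · have hxa : bxor x a ∉ A := fl1_coset_out' haddA hSA hx ha
          simp only [A₂, if_neg hx, if_neg hxa, mul_zero])
  rw [hcardVA, hAcard] at h2b
  have hY : ∑ y, |W A₂ y| ≤ 2 ^ 18 := by
    have hnn : 0 ≤ ∑ y, |W A₂ y| := sum_nonneg fun y _ => abs_nonneg _
    push_cast at h2b
    nlinarith
  -- decomposition and pairing
  have hdecomp : (fun x => (u x : ℝ) - 8 * signOf (f x)) = fun x => A₁ x + (-4) * A₂ x := by
    funext x
    have e : (u x : ℝ) - 8 * signOf (f x) = (((u x - 8 * sZ (f x) : ℤ)) : ℝ) := by push_cast; rw [tp_sZ_cast]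
    rw [e]
    by_cases hx : x ∈ A
    · simp only [A₁, A₂, if_pos hx]; rw [hτ3 x hx]; push_cast; rw [tp_sZ_cast]; ring
    · simp only [A₁, A₂, if_neg hx]; rw [hτ1 x hx, tp_sZ_cast]; ring
  have hpair := ep_pairing18 f g u hu
  rw [hΦeq, hdecomp] at hpair
  have e2 : ∀ y, signOf (g y) * W (fun x => A₁ x + (-4) * A₂ x) y =
      signOf (g y) * W A₁ y + (-4) * (signOf (g y) * W A₂ y) := fun y => by
    rw [sp_W_add, fl1_W_smul]; ring
  rw [sum_congr rfl fun y _ => e2 y, sum_add_distrib, ← mul_sum] at hpair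
  have hP1 : ∑ y, signOf (g y) * W A₁ y ≤ ∑ y, |W A₁ y| := fl1_pairing_le_l1 g (W A₁)
  have hP2 : |∑ y, signOf (g y) * W A₂ y| ≤ ∑ y, |W A₂ y| :=
    (abs_sum_le_sum_abs _ _).trans (sum_le_sum fun y _ => by
      rw [abs_mul]; unfold signOf; split_ifs <;> norm_num)
  have hP2' := (abs_le.1 hP2).1
  have h30 : (2 : ℝ) ^ 30 * (1 - 63 / 64) = 2 ^ 24 := by norm_num
  rw [h30] at hpair
  linarith

end Summit.QuantumAdvantage.QuantumAdvantage.Theorems.CubicForrelation.NearExactIsExact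

end
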